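import Literature.Algebra.Lie.Sl2PairStepDown
import Literature.Algebra.Lie.GL2PairOperators
import Mathlib.Algebra.Lie.Sl2
import Mathlib.Algebra.Lie.OfAssociative
import Mathlib.LinearAlgebra.Eigenspace.Triangularizable
import Mathlib.LinearAlgebra.Eigenspace.Minpoly
import Mathlib.Analysis.Complex.Polynomial.Basic
import HarnessLib

/-!
# Crux `RegularTwistCM` (stmt-Langlands-14069), line `petersson-hermitian-purity`, stub C1 `stub_pairingCore`

The representation-theoretic core of the integral pairing of Harish-Chandra parameters at a complex
place (Clozel 1990, §3.3: the archimedean parameters `{s₁, s₂}` at `ι` and `{t₁, t₂}` at `ῑ` of a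
representation of `GL₂(ℂ)` pair with `s_i - t_j ∈ ℤ`), in the abstract form registered as the stub
`stub_pairingCore` of the lead's skeleton: two COMMUTING complex-linear `𝔤𝔩₂(ℂ)`-actions `L`, `R` on a
complex vector space `V ≠ 0` (the two factors of `𝔤𝔩₂(ℂ) ⊗_ℝ ℂ`), with centre/Casimir scalars
`L 1 = s₁ + s₂`, `∑ L(E_{ab}) L(E_{ba}) = s₁² + s₂² - ½` and `R 1 = t₁ + t₂`,
`∑ R(E_{ab}) R(E_{ba}) = t₁² + t₂² - ½`, such that the twisted diagonal `D(Y) = L(Y) - R(Yᵀ)` (the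
complexified action of `𝔲(2)`: `Ȳ = -Yᵀ` on skew-Hermitian `Y`) is locally finite with INTEGRAL
eigenvalues of `D(E_{jj})` (the weights of the compact torus). Conclusion:
`(s₁ - t₁, s₂ - t₂ ∈ ℤ) ∨ (s₁ - t₂, s₂ - t₁ ∈ ℤ)`.

Proof (Naimark's bottom-`K`-type relation; Naimark 1964, Ch. III §11; cf. Knapp 1986, Ch. II §4).
`e = L E₀₁, f = L E₁₀, h = L(E₀₀ - E₁₁)` and `e' = -R E₁₀, f' = -R E₀₁, h' = R(E₁₁ - E₀₀)` are two
commuting `𝔰𝔩₂`-triples with `4fe + 2h + h² = (s₁-s₂)² - 1`, `4f'e' + 2h' + h'² = (t₁-t₂)² - 1`, and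
the diagonal triple `E = e + e' = D(E₀₁)`, `F = D(E₁₀)`, `H = D(E₀₀) - D(E₁₁)`. Local finiteness gives a
`D`-primitive joint eigenvector (`E v = 0`, `D(E_{jj}) v = k_j v`, `k_j ∈ ℤ`), and weights of primitive
vectors are natural numbers (`IsSl2Triple.HasPrimitiveVectorWith.exists_nat` on a finite-dimensional
`D`-stable subspace); for a primitive `v` of MINIMAL weight `m = k₀ - k₁` the step-down vector `z` of
`Literature.Algebra.Lie.Sl2Pair.stepDown` (primitive of weight `m - 2`) vanishes, so
`(m² - (a+b)²)(m² - (a-b)²) = 0` with `a = s₁ - s₂`, `b = t₁ - t₂`; together with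
`(s₁ + s₂) - (t₁ + t₂) = k₀ + k₁` (the centre `D(1)`) this is the pairing.
-/

set_option linter.dupNamespace false

-- Mathlib idiom (Mathlib/Algebra/Lie/OfAssociative.lean), as in the skeleton and `HarishChandraGL`:
-- commutator brackets on `Matrix (Fin 2) (Fin 2) ℂ` and on `Module.End ℂ V`.
attribute [local instance 100] LieRing.ofAssociativeRing

noncomputable section

open scoped Matrix
open Literature.Algebra.Lie Literature.Algebra.Lie.GL2Pair

namespace Summit.Langlands.Langlands.Theorems.RegularTwistCM

/-! ### The stub -/

/-- C1 (pure algebra; Naimark's bottom `K`-type relation for `SL₂(ℂ)`): two commuting complex-linear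
`𝔤𝔩₂(ℂ)`-actions `L`, `R` on `V ≠ 0` whose centres act by `s₁ + s₂`, `t₁ + t₂` and whose Casimir elements
`∑ E_{ab} E_{ba}` act by `s₁² + s₂² - ½`, `t₁² + t₂² - ½`, such that the twisted diagonal
`D(Y) = L(Y) - R(Yᵀ)` is locally finite on skew-Hermitian `Y` with integral eigenvalues of `D(E_{jj})`,
admit an integral pairing `s_i - t_j ∈ ℤ`. [cite: Knapp1986, Ch. II §4 (context)] -/
theorem stub_pairingCore {V : Type*} [AddCommGroup V] [Module ℂ V] [Nontrivial V]
    (L R : Matrix (Fin 2) (Fin 2) ℂ →ₗ⁅ℂ⁆ Module.End ℂ V)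
    (hLR : ∀ X Y : Matrix (Fin 2) (Fin 2) ℂ, L X * R Y = R Y * L X)
    (s₁ s₂ t₁ t₂ : ℂ)
    (hZL : L 1 = (s₁ + s₂) • (1 : Module.End ℂ V))
    (hCL : ∑ a : Fin 2, ∑ b : Fin 2, L (Matrix.single a b 1) * L (Matrix.single b a 1) =
      (s₁ ^ 2 + s₂ ^ 2 - 1 / 2) • (1 : Module.End ℂ V))
    (hZR : R 1 = (t₁ + t₂) • (1 : Module.End ℂ V))
    (hCR : ∑ a : Fin 2, ∑ b : Fin 2, R (Matrix.single a b 1) * R (Matrix.single b a 1) =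
      (t₁ ^ 2 + t₂ ^ 2 - 1 / 2) • (1 : Module.End ℂ V))
    (hfin : ∀ v : V, ∃ F : Submodule ℂ V, v ∈ F ∧ FiniteDimensional ℂ F ∧
      ∀ Y : Matrix (Fin 2) (Fin 2) ℂ, Yᴴ = -Y → ∀ x ∈ F, (L Y - R Yᵀ) x ∈ F)
    (hint : ∀ (j : Fin 2) (μ : ℂ) (v : V), v ≠ 0 →
      (L (Matrix.single j j 1) - R (Matrix.single j j 1)) v = μ • v → ∃ k : ℤ, μ = k) :
    (∃ k l : ℤ, s₁ - t₁ = k ∧ s₂ - t₂ = l) ∨ (∃ k l : ℤ, s₁ - t₂ = k ∧ s₂ - t₁ = l) := by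
  classical
  /- the six operators -/
  set e : Module.End ℂ V := L (Matrix.single 0 1 (1 : ℂ)) with he_def
  set f : Module.End ℂ V := L (Matrix.single 1 0 (1 : ℂ)) with hf_def
  set h : Module.End ℂ V := L (Matrix.single 0 0 (1 : ℂ) - Matrix.single 1 1 (1 : ℂ)) with hh_def
  set e' : Module.End ℂ V := -R (Matrix.single 1 0 (1 : ℂ)) with he'_def
  set f' : Module.End ℂ V := -R (Matrix.single 0 1 (1 : ℂ)) with hf'_def
  set h' : Module.End ℂ V := R (Matrix.single 1 1 (1 : ℂ) - Matrix.single 0 0 (1 : ℂ)) with hh'_def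
  have hh'_neg : h' = -R (Matrix.single 0 0 (1 : ℂ) - Matrix.single 1 1 (1 : ℂ)) := by rw [hh'_def, ← map_neg, neg_sub]
  have two_eq : ∀ x : Module.End ℂ V, x + x = 2 * x := fun x => (two_mul x).symm
  /- brackets of the first triple -/
  have hhe : h * e - e * h = 2 * e := by
    rw [hh_def, he_def, gl2_map_lie, lie_h_e, map_add, two_eq]
  have hhf : h * f - f * h = -(2 * f) := by
    rw [hh_def, hf_def, gl2_map_lie, lie_h_f, map_neg, map_add, two_eq]
  have hef : e * f - f * e = h := by
    rw [he_def, hf_def, gl2_map_lie, lie_e_f]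
  /- brackets of the second triple -/
  have hhe' : h' * e' - e' * h' = 2 * e' := by
    rw [hh'_neg, he'_def, neg_mul_neg, neg_mul_neg, gl2_map_lie, lie_h_f, map_neg, map_add, two_eq,
      mul_neg]
  have hhf' : h' * f' - f' * h' = -(2 * f') := by
    rw [hh'_neg, hf'_def, neg_mul_neg, neg_mul_neg, gl2_map_lie, lie_h_e, map_add, two_eq, mul_neg,
      neg_neg]
  have hef' : e' * f' - f' * e' = h' := by
    rw [he'_def, hf'_def, neg_mul_neg, neg_mul_neg, hh'_neg, ← neg_sub, gl2_map_lie, lie_e_f]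
  /- the two triples commute -/
  have cross : ∀ X Y : Matrix (Fin 2) (Fin 2) ℂ, L X * (-R Y) = (-R Y) * L X := fun X Y => by
    rw [mul_neg, neg_mul, hLR]
  have cef : e * f' = f' * e := cross _ _
  have ceh : e * h' = h' * e := hLR _ _
  have cfe : f * e' = e' * f := cross _ _
  have cfh : f * h' = h' * f := hLR _ _
  have che : h * e' = e' * h := cross _ _
  have chf : h * f' = f' * h := cross _ _
  have chh : h * h' = h' * h := hLR _ _
  /- the Casimir scalars -/
  set ω : ℂ := (s₁ ^ 2 + s₂ ^ 2 - 1 / 2) - (s₁ + s₂) ^ 2 / 2 with hω_def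
  set ω' : ℂ := (t₁ ^ 2 + t₂ ^ 2 - 1 / 2) - (t₁ + t₂) ^ 2 / 2 with hω'_def
  have hc : 4 * (f * e) + 2 * h + h * h = (2 * ω) • (1 : Module.End ℂ V) :=
    gl2_casimir_sl2 L hZL hCL
  have hc' : 4 * (f' * e') + 2 * h' + h' * h' = (2 * ω') • (1 : Module.End ℂ V) := by
    have t := gl2_casimir_sl2 R hZR hCR
    -- `4 f'e' + 2h' + h'h' = 4 R(E₀₁)R(E₁₀) - 2 R(E₀₀ - E₁₁) + R(E₀₀ - E₁₁)²`, and
    -- `R(E₀₁)R(E₁₀) = R(E₁₀)R(E₀₁) + R(E₀₀ - E₁₁)`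
    have hbr : R (Matrix.single 0 1 (1 : ℂ)) * R (Matrix.single 1 0 (1 : ℂ)) = R (Matrix.single 1 0 (1 : ℂ)) * R (Matrix.single 0 1 (1 : ℂ)) + R (Matrix.single 0 0 (1 : ℂ) - Matrix.single 1 1 (1 : ℂ)) := by
      rw [← sub_eq_iff_eq_add', gl2_map_lie, lie_e_f]
    have e1 : 4 * (f' * e') + 2 * h' + h' * h' =
        4 * (R (Matrix.single 1 0 (1 : ℂ)) * R (Matrix.single 0 1 (1 : ℂ))) + 2 * R (Matrix.single 0 0 (1 : ℂ) - Matrix.single 1 1 (1 : ℂ)) + R (Matrix.single 0 0 (1 : ℂ) - Matrix.single 1 1 (1 : ℂ)) * R (Matrix.single 0 0 (1 : ℂ) - Matrix.single 1 1 (1 : ℂ)) := by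
      rw [hf'_def, he'_def, hh'_neg, neg_mul_neg, hbr]; noncomm_ring
    rw [e1, t]
  /- the diagonal triple in terms of `D(Y) = L Y - R Yᵀ`, and stability -/
  have hEeq : e + e' = L (Matrix.single 0 1 (1 : ℂ)) - R (Matrix.single 0 1 (1 : ℂ))ᵀ := by
    rw [single_one_transpose, he_def, he'_def, ← sub_eq_add_neg]
  have hFeq : f + f' = L (Matrix.single 1 0 (1 : ℂ)) - R (Matrix.single 1 0 (1 : ℂ))ᵀ := by
    rw [single_one_transpose, hf_def, hf'_def, ← sub_eq_add_neg]
  have hHeq : h + h' = (L (Matrix.single 0 0 (1 : ℂ)) - R (Matrix.single 0 0 (1 : ℂ))ᵀ) - (L (Matrix.single 1 1 (1 : ℂ)) - R (Matrix.single 1 1 (1 : ℂ))ᵀ) := by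
    rw [single_one_transpose, single_one_transpose, hh_def, hh'_def, map_sub, map_sub]; abel
  have stabAll : ∀ {F : Submodule ℂ V},
      (∀ Y : Matrix (Fin 2) (Fin 2) ℂ, Yᴴ = -Y → ∀ x ∈ F, (L Y - R Yᵀ) x ∈ F) →
      ∀ Y : Matrix (Fin 2) (Fin 2) ℂ, ∀ x ∈ F, (L Y - R Yᵀ) x ∈ F :=
    fun hF Y x hx => diag_mem_of_skew L R hF Y hx
  /- diagonal brackets -/
  have tEF : (e + e') * (f + f') - (f + f') * (e + e') = h + h' := Sl2Pair.E_F hef hef' cef cfe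
  have tHE : (h + h') * (e + e') - (e + e') * (h + h') = 2 * (e + e') := by
    have t1 : (h + h') * (e + e') - (e + e') * (h + h') =
        (h * e - e * h) + (h' * e' - e' * h') + (h * e' - e' * h) - (e * h' - h' * e) := by noncomm_ring
    rw [t1, hhe, hhe', che, ceh, sub_self, sub_self]; noncomm_ring
  have tHF : (h + h') * (f + f') - (f + f') * (h + h') = -(2 * (f + f')) := Sl2Pair.H_F hhf hhf' chf cfh
  /- weights of primitive vectors are natural numbers (finite-dimensional `𝔰𝔩₂`-theory on a stable
    finite-dimensional subspace containing the vector) -/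
  have weight_nat : ∀ (v : V) (μ : ℂ), v ≠ 0 → (e + e') v = 0 → (h + h') v = μ • v →
      ∃ n : ℕ, μ = n := by
    intro v μ hv0 hEv hHv
    obtain ⟨F, hvF, hFfin, hFst⟩ := hfin v
    have hst := stabAll hFst
    haveI : FiniteDimensional ℂ F := hFfin
    have hEst : ∀ x ∈ F, (e + e') x ∈ F := fun x hx => by rw [hEeq]; exact hst _ x hx
    have hFst' : ∀ x ∈ F, (f + f') x ∈ F := fun x hx => by rw [hFeq]; exact hst _ x hx
    have hHst : ∀ x ∈ F, (h + h') x ∈ F := fun x hx => by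
      rw [hHeq, LinearMap.sub_apply]; exact F.sub_mem (hst _ x hx) (hst _ x hx)
    have h2Est : ∀ x ∈ F, (2 * (e + e')) x ∈ F := fun x hx => by
      rw [two_mul, LinearMap.add_apply]; exact F.add_mem (hEst x hx) (hEst x hx)
    have h2Fst : ∀ x ∈ F, (-(2 * (f + f'))) x ∈ F := fun x hx => by
      rw [LinearMap.neg_apply, two_mul, LinearMap.add_apply]
      exact F.neg_mem (F.add_mem (hFst' x hx) (hFst' x hx))
    -- the case `μ = 0`
    by_cases hμ : μ = 0
    · exact ⟨0, by rw [hμ, Nat.cast_zero]⟩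
    have hv' : (⟨v, hvF⟩ : F) ≠ 0 := fun h0 => hv0 (congrArg Subtype.val h0)
    have hH'ne : (h + h').restrict hHst ≠ 0 := by
      intro h0
      have t : (h + h').restrict hHst ⟨v, hvF⟩ = 0 := by rw [h0, LinearMap.zero_apply]
      have t' : (h + h') v = 0 := congrArg Subtype.val t
      rw [hHv] at t'
      exact hμ ((smul_eq_zero.mp t').resolve_right hv0)
    have triple : IsSl2Triple ((h + h').restrict hHst) ((e + e').restrict hEst) ((f + f').restrict hFst') :=
      { h_ne_zero := hH'ne
        lie_e_f := lie_restrict_eq _ _ _ hEst hFst' hHst tEF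
        lie_h_e_nsmul := by
          rw [lie_restrict_eq _ _ _ hHst hEst h2Est tHE, two_smul]
          ext x
          simp [LinearMap.restrict_apply, two_mul]
        lie_h_f_nsmul := by
          rw [lie_restrict_eq _ _ _ hHst hFst' h2Fst tHF, two_smul]
          ext x
          simp [LinearMap.restrict_apply, two_mul] }
    have prim : triple.HasPrimitiveVectorWith (⟨v, hvF⟩ : F) μ :=
      { ne_zero := hv'
        lie_h := by
          apply Subtype.ext
          simp [LinearMap.restrict_apply, hHv]
        lie_e := by
          apply Subtype.ext
          simp [LinearMap.restrict_apply, hEv] }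
    exact prim.exists_nat
  /- existence of a primitive joint eigenvector of `D(E₀₀)`, `D(E₁₁)` -/
  have exist : ∃ v : V, v ≠ 0 ∧ (e + e') v = 0 ∧ ∃ μ : ℂ, (h + h') v = μ • v := by
    obtain ⟨v₀, hv₀⟩ := exists_ne (0 : V)
    obtain ⟨F, hvF, hFfin, hFst⟩ := hfin v₀
    have hst := stabAll hFst
    haveI : FiniteDimensional ℂ F := hFfin
    haveI : Nontrivial F := ⟨⟨⟨v₀, hvF⟩, 0, fun h0 => hv₀ (congrArg Subtype.val h0)⟩⟩
    have h00st : ∀ x ∈ F, (L (Matrix.single 0 0 (1 : ℂ)) - R (Matrix.single 0 0 (1 : ℂ))) x ∈ F := fun x hx => by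
      have t := hst (Matrix.single 0 0 (1 : ℂ)) x hx; rwa [single_one_transpose] at t
    have h11st : ∀ x ∈ F, (L (Matrix.single 1 1 (1 : ℂ)) - R (Matrix.single 1 1 (1 : ℂ))) x ∈ F := fun x hx => by
      have t := hst (Matrix.single 1 1 (1 : ℂ)) x hx; rwa [single_one_transpose] at t
    have hEst : ∀ x ∈ F, (e + e') x ∈ F := fun x hx => by rw [hEeq]; exact hst _ x hx
    set T₀ : Module.End ℂ F := (L (Matrix.single 0 0 (1 : ℂ)) - R (Matrix.single 0 0 (1 : ℂ))).restrict h00st with hT₀_def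
    set T₁ : Module.End ℂ F := (L (Matrix.single 1 1 (1 : ℂ)) - R (Matrix.single 1 1 (1 : ℂ))).restrict h11st with hT₁_def
    -- an eigenvalue of `T₀` of maximal real part
    have hfinS := T₀.finite_hasEigenvalue
    have hne : hfinS.toFinset.Nonempty := by
      obtain ⟨μ, hμ⟩ := Module.End.exists_eigenvalue T₀
      exact ⟨μ, hfinS.mem_toFinset.mpr hμ⟩
    obtain ⟨μ₀, hμ₀S, hmax⟩ := hfinS.toFinset.exists_max_image (fun μ : ℂ => μ.re) hne
    have hμ₀ : T₀.HasEigenvalue μ₀ := hfinS.mem_toFinset.mp hμ₀S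
    -- `D(E₀₀)` and `D(E₁₁)` commute
    have hcomm : (L (Matrix.single 0 0 (1 : ℂ)) - R (Matrix.single 0 0 (1 : ℂ))) * (L (Matrix.single 1 1 (1 : ℂ)) - R (Matrix.single 1 1 (1 : ℂ))) =
        (L (Matrix.single 1 1 (1 : ℂ)) - R (Matrix.single 1 1 (1 : ℂ))) * (L (Matrix.single 0 0 (1 : ℂ)) - R (Matrix.single 0 0 (1 : ℂ))) := by
      have c1 : L (Matrix.single 0 0 (1 : ℂ)) * L (Matrix.single 1 1 (1 : ℂ)) - L (Matrix.single 1 1 (1 : ℂ)) * L (Matrix.single 0 0 (1 : ℂ)) = 0 := by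
        rw [gl2_map_lie, lie_d_d, map_zero]
      have c2 : R (Matrix.single 0 0 (1 : ℂ)) * R (Matrix.single 1 1 (1 : ℂ)) - R (Matrix.single 1 1 (1 : ℂ)) * R (Matrix.single 0 0 (1 : ℂ)) = 0 := by
        rw [gl2_map_lie, lie_d_d, map_zero]
      have c3 := hLR (Matrix.single 0 0 (1 : ℂ)) (Matrix.single 1 1 (1 : ℂ))
      have c4 := hLR (Matrix.single 1 1 (1 : ℂ)) (Matrix.single 0 0 (1 : ℂ))
      have t : (L (Matrix.single 0 0 (1 : ℂ)) - R (Matrix.single 0 0 (1 : ℂ))) * (L (Matrix.single 1 1 (1 : ℂ)) - R (Matrix.single 1 1 (1 : ℂ))) -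
          (L (Matrix.single 1 1 (1 : ℂ)) - R (Matrix.single 1 1 (1 : ℂ))) * (L (Matrix.single 0 0 (1 : ℂ)) - R (Matrix.single 0 0 (1 : ℂ))) =
          (L (Matrix.single 0 0 (1 : ℂ)) * L (Matrix.single 1 1 (1 : ℂ)) - L (Matrix.single 1 1 (1 : ℂ)) * L (Matrix.single 0 0 (1 : ℂ))) +
          (R (Matrix.single 0 0 (1 : ℂ)) * R (Matrix.single 1 1 (1 : ℂ)) - R (Matrix.single 1 1 (1 : ℂ)) * R (Matrix.single 0 0 (1 : ℂ))) -
          (L (Matrix.single 0 0 (1 : ℂ)) * R (Matrix.single 1 1 (1 : ℂ)) - R (Matrix.single 1 1 (1 : ℂ)) * L (Matrix.single 0 0 (1 : ℂ))) +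
          (L (Matrix.single 1 1 (1 : ℂ)) * R (Matrix.single 0 0 (1 : ℂ)) - R (Matrix.single 0 0 (1 : ℂ)) * L (Matrix.single 1 1 (1 : ℂ))) := by noncomm_ring
      rw [c1, c2, c3, c4, sub_self, sub_self, add_zero, sub_zero, add_zero] at t
      exact sub_eq_zero.mp t
    -- `T₁` preserves the `μ₀`-eigenspace `W` of `T₀`
    set W : Submodule ℂ F := T₀.eigenspace μ₀ with hW_def
    have hT₁W : ∀ w ∈ W, T₁ w ∈ W := by
      intro w hw
      rw [hW_def, Module.End.mem_eigenspace_iff] at hw ⊢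
      apply Subtype.ext
      have t := LinearMap.congr_fun hcomm (w : V)
      have hw' : (L (Matrix.single 0 0 (1 : ℂ)) - R (Matrix.single 0 0 (1 : ℂ))) (w : V) = μ₀ • (w : V) := congrArg Subtype.val hw
      simp only [Module.End.mul_apply] at t
      change (L (Matrix.single 0 0 (1 : ℂ)) - R (Matrix.single 0 0 (1 : ℂ))) ((L (Matrix.single 1 1 (1 : ℂ)) - R (Matrix.single 1 1 (1 : ℂ))) (w : V)) =
        μ₀ • (L (Matrix.single 1 1 (1 : ℂ)) - R (Matrix.single 1 1 (1 : ℂ))) (w : V)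
      rw [t, hw', map_smul]
    haveI : Nontrivial W := Submodule.nontrivial_iff_ne_bot.mpr hμ₀
    obtain ⟨μ₁, hμ₁⟩ := Module.End.exists_eigenvalue (T₁.restrict hT₁W)
    obtain ⟨w, hw⟩ := hμ₁.exists_hasEigenvector
    -- the joint eigenvector `u`
    set u : V := ((w : F) : V) with hu_def
    have hu0 : u ≠ 0 := fun h0 => hw.right (Subtype.ext (Subtype.ext h0))
    have hu₀ : (L (Matrix.single 0 0 (1 : ℂ)) - R (Matrix.single 0 0 (1 : ℂ))) u = μ₀ • u := by
      have t := Module.End.mem_eigenspace_iff.mp w.2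
      exact congrArg Subtype.val t
    have hu₁ : (L (Matrix.single 1 1 (1 : ℂ)) - R (Matrix.single 1 1 (1 : ℂ))) u = μ₁ • u := by
      have t := hw.apply_eq_smul
      rw [LinearMap.restrict_apply] at t
      exact congrArg Subtype.val (congrArg Subtype.val t)
    -- `[D(E₀₀), E] = E`
    have hshift : (L (Matrix.single 0 0 (1 : ℂ)) - R (Matrix.single 0 0 (1 : ℂ))) * (e + e') - (e + e') * (L (Matrix.single 0 0 (1 : ℂ)) - R (Matrix.single 0 0 (1 : ℂ))) = e + e' := by
      have c1 : L (Matrix.single 0 0 (1 : ℂ)) * L (Matrix.single 0 1 (1 : ℂ)) - L (Matrix.single 0 1 (1 : ℂ)) * L (Matrix.single 0 0 (1 : ℂ)) = e := by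
        rw [gl2_map_lie, lie_d0_e]
      have c2 : R (Matrix.single 0 0 (1 : ℂ)) * R (Matrix.single 1 0 (1 : ℂ)) - R (Matrix.single 1 0 (1 : ℂ)) * R (Matrix.single 0 0 (1 : ℂ)) = -R (Matrix.single 1 0 (1 : ℂ)) := by
        rw [gl2_map_lie, lie_d0_f, map_neg]
      have c3 := hLR (Matrix.single 0 0 (1 : ℂ)) (Matrix.single 1 0 (1 : ℂ))
      have c4 := hLR (Matrix.single 0 1 (1 : ℂ)) (Matrix.single 0 0 (1 : ℂ))
      have t : (L (Matrix.single 0 0 (1 : ℂ)) - R (Matrix.single 0 0 (1 : ℂ))) * (e + e') - (e + e') * (L (Matrix.single 0 0 (1 : ℂ)) - R (Matrix.single 0 0 (1 : ℂ))) =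
          (L (Matrix.single 0 0 (1 : ℂ)) * L (Matrix.single 0 1 (1 : ℂ)) - L (Matrix.single 0 1 (1 : ℂ)) * L (Matrix.single 0 0 (1 : ℂ))) +
          (R (Matrix.single 0 0 (1 : ℂ)) * R (Matrix.single 1 0 (1 : ℂ)) - R (Matrix.single 1 0 (1 : ℂ)) * R (Matrix.single 0 0 (1 : ℂ))) +
          (L (Matrix.single 0 1 (1 : ℂ)) * R (Matrix.single 0 0 (1 : ℂ)) - R (Matrix.single 0 0 (1 : ℂ)) * L (Matrix.single 0 1 (1 : ℂ))) -
          (L (Matrix.single 0 0 (1 : ℂ)) * R (Matrix.single 1 0 (1 : ℂ)) - R (Matrix.single 1 0 (1 : ℂ)) * L (Matrix.single 0 0 (1 : ℂ))) := by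
        rw [he_def, he'_def]; noncomm_ring
      rw [c1, c2, c3, c4, sub_self, sub_self, add_zero, sub_zero] at t
      rw [t, he'_def]
    -- `E u = 0`: otherwise `μ₀ + 1` is an eigenvalue of `T₀` of larger real part
    have hEu : (e + e') u = 0 := by
      by_contra hne0
      have hmem : (⟨(e + e') u, hEst u (w : F).2⟩ : F) ∈ T₀.eigenspace (μ₀ + 1) := by
        rw [Module.End.mem_eigenspace_iff]
        apply Subtype.ext
        change (L (Matrix.single 0 0 (1 : ℂ)) - R (Matrix.single 0 0 (1 : ℂ))) ((e + e') u) = (μ₀ + 1) • (e + e') u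
        have t : (L (Matrix.single 0 0 (1 : ℂ)) - R (Matrix.single 0 0 (1 : ℂ))) ((e + e') u) - (e + e') ((L (Matrix.single 0 0 (1 : ℂ)) - R (Matrix.single 0 0 (1 : ℂ))) u) =
            (e + e') u := LinearMap.congr_fun hshift u
        rw [hu₀, map_smul, sub_eq_iff_eq_add] at t
        rw [t, add_smul, one_smul, add_comm]
      have hev : T₀.HasEigenvalue (μ₀ + 1) :=
        Module.End.hasEigenvalue_of_hasEigenvector ⟨hmem, fun h0 => hne0 (congrArg Subtype.val h0)⟩
      have hle := hmax (μ₀ + 1) (hfinS.mem_toFinset.mpr hev)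
      simp only [Complex.add_re, Complex.one_re] at hle
      linarith
    refine ⟨u, hu0, hEu, μ₀ - μ₁, ?_⟩
    rw [hHeq, single_one_transpose, single_one_transpose, LinearMap.sub_apply, hu₀, hu₁, sub_smul]
  /- a primitive vector of MINIMAL natural weight -/
  have hP : ∃ n : ℕ, ∃ v : V, v ≠ 0 ∧ (e + e') v = 0 ∧ (h + h') v = (n : ℂ) • v := by
    obtain ⟨v, hv0, hEv, μ, hHv⟩ := exist
    obtain ⟨n, rfl⟩ := weight_nat v μ hv0 hEv hHv
    exact ⟨n, v, hv0, hEv, hHv⟩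
  obtain ⟨v, hv0, hEv, hHv⟩ := Nat.find_spec hP
  have hmin : ∀ n : ℕ, n < Nat.find hP →
      ¬ ∃ v : V, v ≠ 0 ∧ (e + e') v = 0 ∧ (h + h') v = (n : ℂ) • v :=
    fun n hn => Nat.find_min hP hn
  set n₀ : ℕ := Nat.find hP with hn₀_def
  /- the step-down vector vanishes, hence so does the step-down scalar -/
  obtain ⟨hzE, hzH, hzp⟩ :=
    Sl2Pair.stepDown hhe hhf hef hhe' hhf' hef' cef ceh cfe cfh che chf chh hc hc' hEv hHv
  set z : V := (n₀ : ℂ) ^ 2 • (f - f') v - ((n₀ : ℂ) / 2) • (h - h') ((f + f') v) -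
    (ω - ω') • (f + f') v with hz_def
  have hz : z = 0 := by
    by_contra hz0
    obtain ⟨n, hn⟩ := weight_nat z ((n₀ : ℂ) - 2) hz0 hzE hzH
    have hn2 : n + 2 = n₀ := by
      have t : ((n + 2 : ℕ) : ℂ) = (n₀ : ℂ) := by push_cast; rw [← hn]; ring
      exact_mod_cast t
    refine hmin n (by omega) ⟨z, hz0, hzE, ?_⟩
    rw [hzH, hn]
  have hΦ : (n₀ : ℂ) ^ 2 * (ω + ω' + 1) - (n₀ : ℂ) ^ 4 / 4 - (ω - ω') ^ 2 = 0 := by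
    rw [hz, map_zero] at hzp
    exact (smul_eq_zero.mp hzp.symm).resolve_right hv0
  have hprod : ((n₀ : ℂ) ^ 2 - (s₁ - s₂ + (t₁ - t₂)) ^ 2) *
      ((n₀ : ℂ) ^ 2 - (s₁ - s₂ - (t₁ - t₂)) ^ 2) = 0 := by
    have hfac := Sl2Pair.stepDown_scalar_eq (a := s₁ - s₂) (b := t₁ - t₂) (m := (n₀ : ℂ)) (ω := ω)
      (ω' := ω') (by rw [hω_def]; ring) (by rw [hω'_def]; ring)
    rw [hΦ] at hfac
    have h4 : (-(1 / 4) : ℂ) ≠ 0 := by norm_num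
    exact (mul_eq_zero.mp hfac.symm).resolve_left h4
  /- torus integrality at `v`: `D(E₀₀) v = k₀ v`, `D(E₁₁) v = k₁ v` -/
  have hD1 : (L 1 - R 1) v = ((s₁ + s₂) - (t₁ + t₂)) • v := by
    rw [LinearMap.sub_apply, hZL, hZR, LinearMap.smul_apply, LinearMap.smul_apply,
      Module.End.one_apply, sub_smul]
  have hsum : (L (Matrix.single 0 0 (1 : ℂ)) - R (Matrix.single 0 0 (1 : ℂ))) v + (L (Matrix.single 1 1 (1 : ℂ)) - R (Matrix.single 1 1 (1 : ℂ))) v =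
      ((s₁ + s₂) - (t₁ + t₂)) • v := by
    rw [← hD1, one_eq_single_add_single, map_add, map_add]
    simp only [LinearMap.sub_apply, LinearMap.add_apply]
    abel
  have hdiff : (L (Matrix.single 0 0 (1 : ℂ)) - R (Matrix.single 0 0 (1 : ℂ))) v - (L (Matrix.single 1 1 (1 : ℂ)) - R (Matrix.single 1 1 (1 : ℂ))) v = (n₀ : ℂ) • v := by
    rw [← hHv, hHeq, single_one_transpose, single_one_transpose]; rfl
  have h00 : (L (Matrix.single 0 0 (1 : ℂ)) - R (Matrix.single 0 0 (1 : ℂ))) v = (((s₁ + s₂) - (t₁ + t₂) + n₀) / 2) • v := by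
    linear_combination (norm := module) (1 / 2 : ℂ) • hsum + (1 / 2 : ℂ) • hdiff
  have h11 : (L (Matrix.single 1 1 (1 : ℂ)) - R (Matrix.single 1 1 (1 : ℂ))) v = (((s₁ + s₂) - (t₁ + t₂) - n₀) / 2) • v := by
    linear_combination (norm := module) (1 / 2 : ℂ) • hsum - (1 / 2 : ℂ) • hdiff
  obtain ⟨k₀, hk₀⟩ := hint 0 _ v hv0 h00
  obtain ⟨k₁, hk₁⟩ := hint 1 _ v hv0 h11
  /- the four cases -/
  rcases mul_eq_zero.mp hprod with hc1 | hc2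
  · rw [sub_eq_zero, eq_comm, sq_eq_sq_iff_eq_or_eq_neg] at hc1
    rcases hc1 with h1 | h1
    · exact Or.inr ⟨k₀, k₁, by linear_combination hk₀ + h1 / 2, by linear_combination hk₁ - h1 / 2⟩
    · exact Or.inr ⟨k₁, k₀, by linear_combination hk₁ + h1 / 2, by linear_combination hk₀ - h1 / 2⟩
  · rw [sub_eq_zero, eq_comm, sq_eq_sq_iff_eq_or_eq_neg] at hc2
    rcases hc2 with h1 | h1
    · exact Or.inl ⟨k₀, k₁, by linear_combination hk₀ + h1 / 2, by linear_combination hk₁ - h1 / 2⟩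
    · exact Or.inl ⟨k₁, k₀, by linear_combination hk₁ + h1 / 2, by linear_combination hk₀ - h1 / 2⟩

end Summit.Langlands.Langlands.Theorems.RegularTwistCM

end
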